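import Mathlib
import Summits.MatrixMultiplication.MatrixMultiplication.Theses.MatrixPointInterpolation
import Summits.MatrixMultiplication.MatrixMultiplication.Theorems.MatrixPointInterpolationWindowedKaplanskyCapelli

/-!
# `MatrixPointInterpolation.WindowedKaplansky` (stmt-MatrixMultiplication-18945) — helper file 4:
# point size `k = 3`: middle-slot separation, local linear dependence, a low-rank combination

For `k = 3` the Cayley–Hamilton–Capelli polynomial `P_3(y; z, x, w)` expanded along its *middle*
separator reads `P_3(y; z, x, w) = ∑_{p ≠ q} (y^p z y^q) · x · N_{pq}(w)` with
`N_{pq}(w) = ±(y^r w y^s − y^s w y^r)`, `{r, s} = {0,1,2,3} ∖ {p, q}` (`capPow_three_mid`, a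
24-term computation).  If `A` masquerades as `M₃` to degree `2d` and generates `M_n` in degree `d`,
the window gives `P_3(Y; Z, X, W) = 0` for `Y ∈ V_L`, `Z, W ∈ V_e`, `X ∈ V_d = M_n` (a full slot)
whenever `6L + d + 2e ≤ 2d`; were the twelve matrices `Y^p Z Y^q` linearly independent, tensor
separation would give `N_{23}(W) = [W, Y] = 0` for all `W ∈ V_e ∋ A 0, A 1`, so `Y` would be scalar and
the twelve matrices pairwise proportional — a contradiction.  Hence (`midLeft_not_linearIndependent`)
**for every `Y ∈ V_L` and `Z ∈ V_e` the twelve operators `Z ↦ Y^p Z Y^q` are locally linearly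
dependent on `V_e`**.  The file also proves the Amitsur–Aupetit–Brešar–Šemrl lemma (locally
linearly dependent operators `T_1, …, T_m` admit a nontrivial combination of rank `≤ m − 1`,
`exists_finrank_range_le_of_locally_linearDependent`, via "affine independence is cofinite",
`finite_setOf_not_linearIndependent_add_smul`) and concludes (`exists_finrank_range_midOp_le`) that some
nonzero polynomial `g(L_Y, R_Y) = ∑ c_{pq} L_{Y^p} R_{Y^q}` in the two commuting multiplication operators
has rank `≤ 11` on `V_e` — the entry point of the block-sparsity count recorded in the item's census
(every element of `V_L` has an eigenvalue of multiplicity `≥ n / C_L`).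
-/

namespace Summit.MatrixMultiplication.MatrixMultiplication.Theorems

namespace Masquerade

open Equiv

section mid

variable {R : Type*} [Ring R]

/-- The twelve left factors `y^p z y^q`, `p ≠ q ∈ {0,1,2,3}` (lexicographic in `(p, q)`).
[folklore] -/
def midLeft (y z : R) : Fin 12 → R :=
  ![1 * z * y, 1 * z * y ^ 2, 1 * z * y ^ 3, y * z * 1, y * z * y ^ 2, y * z * y ^ 3, y ^ 2 * z * 1,
    y ^ 2 * z * y, y ^ 2 * z * y ^ 3, y ^ 3 * z * 1, y ^ 3 * z * y, y ^ 3 * z * y ^ 2]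

/-- The twelve right factors `N_{pq}(w) = ±(y^r w y^s − y^s w y^r)`, `{r,s}` the two exponents not in
`{p,q}`, signed by the permutations `(p,q,r,s)`, `(p,q,s,r)`. [folklore] -/
def midRight (y w : R) : Fin 12 → R :=
  ![(y ^ 2 * w * y ^ 3) - y ^ 3 * w * y ^ 2,
  -(y * w * y ^ 3) + y ^ 3 * w * y,
  (y * w * y ^ 2) - y ^ 2 * w * y,
  -(y ^ 2 * w * y ^ 3) + y ^ 3 * w * y ^ 2,
  (1 * w * y ^ 3) - y ^ 3 * w * 1,
  -(1 * w * y ^ 2) + y ^ 2 * w * 1,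
  (y * w * y ^ 3) - y ^ 3 * w * y,
  -(1 * w * y ^ 3) + y ^ 3 * w * 1,
  (1 * w * y) - y * w * 1,
  -(y * w * y ^ 2) + y ^ 2 * w * y,
  (1 * w * y ^ 2) - y ^ 2 * w * 1,
  -(1 * w * y) + y * w * 1]

/-- **Middle-slot expansion of `P_3`**: `P_3(y; z, x, w) = ∑_{p≠q} (y^p z y^q) x N_{pq}(w)`.
[folklore] -/
theorem capPow_three_mid (y z x w : R) :
    capPow 3 y ![z, x, w] = ∑ i : Fin 12, midLeft y z i * x * midRight y w i := by
  simp only [capPow, capMon, Finset.univ_perm_fin_succ, Finset.sum_map, Fintype.sum_prod_type,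
    Fin.sum_univ_succ, Finset.univ_unique, Finset.sum_singleton,
    Equiv.toEmbedding_apply, Perm.decomposeFin.symm_sign, Perm.decomposeFin_symm_apply_zero,
    Perm.decomposeFin_symm_apply_succ, midLeft, midRight]
  simp [Fin.succ_zero_eq_one, swap_apply_def, Units.smul_def, List.ofFn_succ]
  noncomm_ring

/-- The right factor over `(p,q) = (2,3)` is the commutator `[w, y]`. [folklore] -/
theorem midRight_eight (y w : R) : midRight y w 8 = w * y - y * w := by
  simp [midRight]

end mid

/-! ### Locally linearly dependent operators (Amitsur; Aupetit; Brešar–Šemrl) -/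

section lld

variable {V W : Type*} [AddCommGroup V] [Module ℂ V] [AddCommGroup W] [Module ℂ W]

/-- Linear independence of an affine family `p_i + t q_i` holds for all but finitely many `t` once it
holds at `t = 0` (a left inverse turns the question into `1 + t M` being invertible). [folklore] -/
theorem finite_setOf_not_linearIndependent_add_smul {r : ℕ} {p q : Fin r → W}
    (hp : LinearIndependent ℂ p) :
    Set.Finite {t : ℂ | ¬ LinearIndependent ℂ (fun i => p i + t • q i)} := by
  classical
  -- the maps `c ↦ ∑ c_i p_i`, `c ↦ ∑ c_i q_i`
  let P : (Fin r → ℂ) →ₗ[ℂ] W := Fintype.linearCombination ℂ p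
  let Q : (Fin r → ℂ) →ₗ[ℂ] W := Fintype.linearCombination ℂ q
  have hPinj : LinearMap.ker P = ⊥ := by
    refine LinearMap.ker_eq_bot'.2 fun c hc => ?_
    funext i
    exact Fintype.linearIndependent_iff.1 hp c
      (by simpa [P, Fintype.linearCombination_apply] using hc) i
  obtain ⟨Λ, hΛ⟩ := LinearMap.exists_leftInverse_of_injective P hPinj
  let M : Module.End ℂ (Fin r → ℂ) := Λ.comp Q
  refine ((M.finite_hasEigenvalue.image fun μ => -μ⁻¹).union (Set.finite_singleton 0)).subset ?_
  intro t ht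
  simp only [Set.mem_setOf_eq] at ht
  by_cases ht0 : t = 0
  · exact Or.inr ht0
  · left
    -- a nontrivial relation `∑ c_i (p_i + t q_i) = 0`
    obtain ⟨c, hc, i, hi⟩ := Fintype.not_linearIndependent_iff.1 ht
    have hc' : P c + t • Q c = 0 := by
      simp only [P, Q, Fintype.linearCombination_apply, Finset.smul_sum, ← Finset.sum_add_distrib]
      simpa [smul_add, smul_smul, mul_comm] using hc
    have hMc : M c = (-t⁻¹) • c := by
      have h1 : Λ (P c) = c := by simpa using congrArg (fun f => f c) hΛ
      have : Λ (P c) + t • Λ (Q c) = 0 := by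
        rw [← map_smul, ← map_add, hc', map_zero]
      rw [h1] at this
      simp only [M, LinearMap.comp_apply, neg_smul]
      rw [eq_neg_iff_add_eq_zero, ← smul_right_injective _ ht0 |>.eq_iff]
      · simp [smul_smul, mul_inv_cancel₀ ht0, add_comm, this]
    have hc0 : c ≠ 0 := fun h => hi (by simp [h])
    refine ⟨-t⁻¹, Module.End.hasEigenvalue_of_hasEigenvector ⟨?_, hc0⟩, by simp [inv_neg, neg_neg]⟩
    rw [Module.End.mem_eigenspace_iff]
    exact hMc

/-- **Locally linearly dependent operators have a low-rank combination** (Amitsur 1965; Aupetit;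
Brešar–Šemrl 1999): if `T_0, …, T_{m-1} : V → W` satisfy "`T_0 v, …, T_{m-1} v` are linearly
dependent for every `v`", then some nontrivial combination `∑ c_i T_i` has rank `≤ m - 1`.
[folklore] -/
theorem exists_finrank_range_le_of_locally_linearDependent [FiniteDimensional ℂ W] :
    ∀ (m : ℕ) (T : Fin m → V →ₗ[ℂ] W), (∀ v, ¬ LinearIndependent ℂ (fun i => T i v)) →
      ∃ c : Fin m → ℂ, c ≠ 0 ∧ Module.finrank ℂ (LinearMap.range (∑ i, c i • T i)) ≤ m - 1
  | 0, T, h => (h 0 (linearIndependent_empty_type)).elim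
  | m + 1, T, h => by
    classical
    by_cases hex : ∃ v₀, LinearIndependent ℂ (fun i : Fin m => T (Fin.castSucc i) v₀)
    · obtain ⟨v₀, hv₀⟩ := hex
      -- the last operator at `v₀` is a combination of the others
      have hdep := h v₀
      have hsplit : (fun i : Fin (m + 1) => T i v₀) =
          Fin.snoc (fun i : Fin m => T (Fin.castSucc i) v₀) (T (Fin.last m) v₀) := by
        ext i
        refine Fin.lastCases ?_ (fun j => ?_) i <;> simp
      rw [hsplit, linearIndependent_finSnoc, not_and, not_not] at hdep
      obtain ⟨α, hα⟩ := (Submodule.mem_span_range_iff_exists_fun ℂ).1 (hdep hv₀)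
      -- `S = T_last - ∑ α_i T_i`
      let c : Fin (m + 1) → ℂ := Fin.snoc (fun i => -α i) 1
      let S : V →ₗ[ℂ] W := ∑ i, c i • T i
      have hS : S = T (Fin.last m) - ∑ i : Fin m, α i • T (Fin.castSucc i) := by
        simp only [S, c, Fin.sum_univ_castSucc, Fin.snoc_castSucc, Fin.snoc_last, one_smul, neg_smul,
          Finset.sum_neg_distrib]
        abel
      have hSv₀ : S v₀ = 0 := by
        rw [hS, LinearMap.sub_apply, LinearMap.sum_apply, sub_eq_zero, ← hα]
        simp
      -- key step: `S v ∈ U := span (T_i v₀)` for every `v`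
      let U := Submodule.span ℂ (Set.range fun i : Fin m => T (Fin.castSucc i) v₀)
      have hkey : ∀ v, S v ∈ U := by
        intro v
        by_contra hSv
        have hind0 : LinearIndependent ℂ
            (Fin.snoc (fun i : Fin m => T (Fin.castSucc i) v₀) (S v) : Fin (m + 1) → W) :=
          linearIndependent_finSnoc.2 ⟨hv₀, hSv⟩
        let q : Fin (m + 1) → W := Fin.snoc (α := fun _ => W) (fun i : Fin m => T (Fin.castSucc i) v) (0 : W)
        have hfin := finite_setOf_not_linearIndependent_add_smul (q := q) hind0
        obtain ⟨t, ht⟩ := (hfin.union (Set.finite_singleton (0 : ℂ))).infinite_compl.nonempty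
        simp only [Set.mem_compl_iff, Set.mem_union, Set.mem_setOf_eq, Set.mem_singleton_iff,
          not_or, not_not] at ht
        obtain ⟨hind, ht0⟩ := ht
        -- the family `T_i (v₀ + t v)` is a triangular transform of that independent family
        apply h (v₀ + t • v)
        have hsplit' : (fun i : Fin (m + 1) => T i (v₀ + t • v)) =
            Fin.snoc (fun i : Fin m => T (Fin.castSucc i) v₀ + t • T (Fin.castSucc i) v)
              (T (Fin.last m) (v₀ + t • v)) := by
          ext i
          refine Fin.lastCases ?_ (fun j => ?_) i <;> simp
        rw [hsplit', linearIndependent_finSnoc]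
        have hfam : (fun i : Fin (m + 1) =>
            (Fin.snoc (fun i : Fin m => T (Fin.castSucc i) v₀) (S v) : Fin (m + 1) → W) i + t • q i) =
            (Fin.snoc (fun i : Fin m => T (Fin.castSucc i) v₀ + t • T (Fin.castSucc i) v) (S v) :
              Fin (m + 1) → W) := by
          ext i
          refine Fin.lastCases ?_ (fun j => ?_) i <;> simp [q]
        rw [hfam, linearIndependent_finSnoc] at hind
        refine ⟨hind.1, fun hmem => hind.2 ?_⟩
        -- `T_last (v₀ + t v) = ∑ α_i (T_i v₀ + t T_i v) + t S v`
        have hlast : T (Fin.last m) (v₀ + t • v) =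
            ∑ i : Fin m, α i • (T (Fin.castSucc i) v₀ + t • T (Fin.castSucc i) v) + t • S v := by
          have e1 : T (Fin.last m) = S + ∑ i : Fin m, α i • T (Fin.castSucc i) := by
            rw [hS]; abel
          rw [e1]
          simp only [LinearMap.add_apply, LinearMap.sum_apply, LinearMap.smul_apply, map_add,
            map_smul, hSv₀, zero_add, smul_add, Finset.sum_add_distrib, Finset.smul_sum]
          simp_rw [smul_comm t (α _)]
          abel
        rw [hlast] at hmem
        have hsum : ∑ i : Fin m, α i • (T (Fin.castSucc i) v₀ + t • T (Fin.castSucc i) v) ∈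
            Submodule.span ℂ (Set.range fun i : Fin m =>
              T (Fin.castSucc i) v₀ + t • T (Fin.castSucc i) v) :=
          Submodule.sum_mem _ fun i _ => Submodule.smul_mem _ _ (Submodule.subset_span ⟨i, rfl⟩)
        have htS := Submodule.sub_mem _ hmem hsum
        rw [add_sub_cancel_left] at htS
        have := Submodule.smul_mem _ t⁻¹ htS
        rwa [smul_smul, inv_mul_cancel₀ ht0, one_smul] at this
      refine ⟨c, ?_, ?_⟩
      · intro hc
        have := congrFun hc (Fin.last m)
        simp [c] at this
      · have hrange : LinearMap.range S ≤ U := by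
          rintro _ ⟨v, rfl⟩
          exact hkey v
        calc Module.finrank ℂ (LinearMap.range (∑ i, c i • T i)) = Module.finrank ℂ (LinearMap.range S) := rfl
          _ ≤ Module.finrank ℂ U := Submodule.finrank_mono hrange
          _ ≤ m := (finrank_range_le_card _).trans (by simp)
          _ = m + 1 - 1 := rfl
    · -- the first `m` operators are already locally dependent: induct
      push Not at hex
      obtain ⟨c', hc', hrank⟩ := exists_finrank_range_le_of_locally_linearDependent m
        (fun i => T (Fin.castSucc i)) hex
      refine ⟨Fin.snoc c' 0, ?_, ?_⟩
      · intro hc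
        apply hc'
        funext i
        simpa using congrFun hc (Fin.castSucc i)
      · have e : (∑ i : Fin (m + 1), (Fin.snoc c' 0 : Fin (m + 1) → ℂ) i • T i) =
            ∑ i : Fin m, c' i • T (Fin.castSucc i) := by
          rw [Fin.sum_univ_castSucc]
          simp
        rw [e]
        exact hrank.trans (by omega)

end lld

section three

variable {n d : ℕ} {A : Fin 2 → Matrix (Fin n) (Fin n) ℂ}

/-- **Local linear dependence for `k = 3`.**  If `A` masquerades as `M₃` to degree `2d` and generates
`M_n` in degree `d`, then for `Y ∈ V_L` and `Z ∈ V_e` (`1 ≤ e`, `6L + d + 2e ≤ 2d`) the twelve matrices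
`Y^p Z Y^q`, `p ≠ q ∈ {0,1,2,3}`, are linearly dependent. [folklore] -/
theorem midLeft_not_linearIndependent
    (hspan : Submodule.span ℂ {M : Matrix (Fin n) (Fin n) ℂ |
      ∃ w : List (Fin 2), w.length ≤ d ∧ (w.map A).prod = M} = ⊤)
    (hmasq : ∀ (T : Finset (List (Fin 2))) (c : List (Fin 2) → ℂ), (∀ w ∈ T, w.length ≤ 2 * d) →
      (∀ B : Fin 2 → Matrix (Fin 3) (Fin 3) ℂ, (∑ w ∈ T, c w • (w.map B).prod) = 0) →
      (∑ w ∈ T, c w • (w.map A).prod) = 0)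
    {L e : ℕ} (he : 1 ≤ e) (hbudget : 6 * L + d + 2 * e ≤ 2 * d)
    {Y Z : Matrix (Fin n) (Fin n) ℂ} (hY : Y ∈ wordSpan A L) (hZ : Z ∈ wordSpan A e) :
    ¬ LinearIndependent ℂ (midLeft Y Z) := by
  intro hind
  have hX : ∀ X : Matrix (Fin n) (Fin n) ℂ, X ∈ wordSpan A d := fun X => by
    change X ∈ Submodule.span ℂ _
    rw [hspan]
    exact Submodule.mem_top
  -- the window, with the full slot in the middle
  have hvan : ∀ W ∈ wordSpan A e, ∀ X : Matrix (Fin n) (Fin n) ℂ,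
      ∑ i : Fin 12, midLeft Y Z i * X * midRight Y W i = 0 := by
    intro W hW X
    rw [← capPow_three_mid]
    refine capPow_eq_zero_of_window hmasq (L := L) (e := ![e, d, e]) ?_ hY ?_
    · simp only [Fin.sum_univ_three, Matrix.cons_val_zero, Matrix.cons_val_one, Matrix.cons_val]
      omega
    · intro i
      fin_cases i
      · simpa using hZ
      · simpa using hX X
      · simpa using hW
  -- separation: `[W, Y] = 0` for every `W ∈ V_e`, so `Y` is scalar
  have hcomm : ∀ i, Y * A i = A i * Y := by
    intro i
    have h := eq_zero_of_sum_mul_mul_eq_zero hind (hvan (A i) (gen_mem_wordSpan A he i)) 8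
    rw [midRight_eight] at h
    exact (sub_eq_zero.1 h).symm
  obtain ⟨s, hs⟩ := LongMasqueradeNeg.scalar_of_commute_gens hspan hcomm
  -- then two of the twelve left factors coincide
  have h03 : midLeft Y Z 0 = midLeft Y Z 3 := by
    simp [midLeft, hs]
  exact absurd (hind.injective h03) (by decide)

/-- Left exponents of the twelve operators. [folklore] -/
def midExpL : Fin 12 → ℕ := ![0, 0, 0, 1, 1, 1, 2, 2, 2, 3, 3, 3]

/-- Right exponents of the twelve operators. [folklore] -/
def midExpR : Fin 12 → ℕ := ![1, 2, 3, 0, 2, 3, 0, 1, 3, 0, 1, 2]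

/-- The twelve operators `Z ↦ Y^p Z Y^q` (`p ≠ q ∈ {0,1,2,3}`) as linear maps. [folklore] -/
def midOp (Y : Matrix (Fin n) (Fin n) ℂ) (i : Fin 12) :
    Matrix (Fin n) (Fin n) ℂ →ₗ[ℂ] Matrix (Fin n) (Fin n) ℂ :=
  (LinearMap.mulLeft ℂ (Y ^ midExpL i)).comp (LinearMap.mulRight ℂ (Y ^ midExpR i))

/-- `midOp` computes `midLeft`. [folklore] -/
theorem midOp_apply (Y Z : Matrix (Fin n) (Fin n) ℂ) (i : Fin 12) : midOp Y i Z = midLeft Y Z i := by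
  fin_cases i <;> simp [midOp, midLeft, midExpL, midExpR, mul_assoc]

/-- **A low-rank combination for `k = 3`.**  If `A` masquerades as `M₃` to degree `2d` and generates
`M_n` in degree `d`, then for every `Y ∈ V_L` (`1 ≤ e`, `6L + d + 2e ≤ 2d`) some nontrivial
combination `∑_{p≠q} c_{pq} (Z ↦ Y^p Z Y^q)` — a polynomial `g(L_Y, R_Y)` in the two commuting
multiplication operators — has rank `≤ 11` on `V_e`.  (Local linear dependence,
`midLeft_not_linearIndependent`, plus the Amitsur–Brešar–Šemrl lemma.) [folklore] -/
theorem exists_finrank_range_midOp_le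
    (hspan : Submodule.span ℂ {M : Matrix (Fin n) (Fin n) ℂ |
      ∃ w : List (Fin 2), w.length ≤ d ∧ (w.map A).prod = M} = ⊤)
    (hmasq : ∀ (T : Finset (List (Fin 2))) (c : List (Fin 2) → ℂ), (∀ w ∈ T, w.length ≤ 2 * d) →
      (∀ B : Fin 2 → Matrix (Fin 3) (Fin 3) ℂ, (∑ w ∈ T, c w • (w.map B).prod) = 0) →
      (∑ w ∈ T, c w • (w.map A).prod) = 0)
    {L e : ℕ} (he : 1 ≤ e) (hbudget : 6 * L + d + 2 * e ≤ 2 * d)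
    {Y : Matrix (Fin n) (Fin n) ℂ} (hY : Y ∈ wordSpan A L) :
    ∃ c : Fin 12 → ℂ, c ≠ 0 ∧
      Module.finrank ℂ (LinearMap.range (∑ i, c i • (midOp Y i).domRestrict (wordSpan A e))) ≤ 11 :=
  exists_finrank_range_le_of_locally_linearDependent 12
    (fun i => (midOp Y i).domRestrict (wordSpan A e)) fun Z => by
      simpa [midOp_apply] using midLeft_not_linearIndependent hspan hmasq he hbudget hY Z.2

end three

end Masquerade

end Summit.MatrixMultiplication.MatrixMultiplication.Theorems
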